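import Summits.ResolutionOfSingularities.ResolutionOfSingularities.Theorems.HilbertSamuelEliminationSigmaMaxModificationsCorridor3WLadderStrataBirthsTopRebirthStep
import Summits.ResolutionOfSingularities.ResolutionOfSingularities.Theorems.HilbertSamuelEliminationSigmaMaxModificationsCorridor3WLadderStrataDepthRuledComponent
import HarnessLib

/-!
# [OURS · L1 W4.2] `Corridor3WLadderStrataDepthRuledNoJump` — res-D-brk-3's ROW-J STEP LEMMA with the SURFACE branch made CHAR-FREE:
# «surface centre at `x_n`» replaces «near fibre over `x_n` a subsingleton» (no Thm. 3.14, no `CharHypothesis`; serves `p = 2`)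

Crux chain w42 (`SigmaMaxModifications`, stmt-ResolutionOfSingularities-18506; conjunct `SigmaMaxModificationsCorridor3`,
stmt-ResolutionOfSingularities-19249); res-type-053 as «standing reader for 067 `RebirthDictionary3`» (res-L1-w42-plan-1 RULING v3.14-16
(EO)) after (DG) ROW-J SUPPORT (p525662 · p526642 · p527422 · p528109). res-D-brk-3's step lemma `noDepthJumpAt_of_dichotomyAt`
(`…StrataBirthsTopRebirthStep`, p-module of the (CA) re-cut) takes, in its SURFACE branch, the subsingleton-ness of the NEAR fibre
`f⁻¹(x_n) ∩ X_{n+1}(ν)` — which the line obtains from CJS Thm. 3.14 under `CharHypothesis`. This file supplies the same conclusion from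
the DIMENSION of the whole fibre instead (LIB `PermissibleBlowupFibreDimension` / `FibreCoheightInequalitySharp`, via
`hasSandwichAt_closure_image_of_surface_centre` of `…StrataDepthRuled`): at a step under the cycle invariant whose canonical centre has
codimension `≥ 2` at `x_n` in its support, NO component through `x_{n+1}` jumps in depth — in every characteristic. OURS (cell
res-hironaka, slot W4.2); NOT statements of H. Hironaka's manuscript [Hironaka2017] nor of [CossartJannsenSaito2020]; AI-proved, weaker than
expert review. Sorry-free PROOF file (no definition, no named fact, no binder; per step). `--supports stmt-ResolutionOfSingularities-19249 --as helper`.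

* `noDepthJumpAt_of_surface_centre` — brk-3's conclusion shape `∀ Z' ∈ componentsThrough 3 ν s', closure (f.base '' Z') ∈ componentsIn … →
  HasSandwichAt s' Z' → HasSandwichAt s (closure (f.base '' Z'))` from `2 ≤ codim_{V(C)}(x_n)` (the domination hypothesis is not used).
* `noDepthJumpAt_of_dichotomyAt_charFree` — brk-3's STEP LEMMA with the surface disjunct replaced by «some canonical centre `C ∋ x_n` has
  `2 ≤ codim_{V(C)}(x_n)`»: curve branch = `noDepthJumpAt_of_frameAt` (modus tollens on the rebirth dictionary at this step), surface
  branch = `noDepthJumpAt_of_surface_centre`.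
* `exists_fibre_component_subset_of_depthJumpAt` — the CURVE branch's geometric content for the dictionary's discharge: at a step whose
  centre has codimension `≥ 1` at `x_n`, a depth jump hands `Z'` a whole irreducible component of the fibre `f⁻¹(x_n)` through `x_{n+1}`
  (re-export of `exists_fibre_component_subset_of_hasSandwichAt` in the event's shape).
-/

noncomputable section

set_option linter.dupNamespace false

open CategoryTheory AlgebraicGeometry TopologicalSpace Topology Order IsLocalRing Polynomial
open Summit.ResolutionOfSingularities.ResolutionOfSingularities.Theorems.CampaignW42
open Literature.AlgebraicGeometry.Resolution Literature.RingTheory.HilbertSamuel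
open Summit.ResolutionOfSingularities.ResolutionOfSingularities.Theorems.SigmaMaxModificationsCorridor3
open Scheme.IdealSheafData

namespace Summit.ResolutionOfSingularities.ResolutionOfSingularities.Theorems.SigmaMaxModificationsCorridor3.Moving

universe u

variable {R : ∀ S : Scheme.{u}, CentreSeq S → Prop} {ν : ℕ → ℕ}

/-- **SURFACE BRANCH, CHAR-FREE.** At one canonical near step `s → s'` at level `3` under the cycle invariant (admissible functional
oracle, `ν ≠ Φ^{(3)}`), `x_n` closed, step projection `f`, with a canonical centre `C` of codimension `≥ 2` at `x_n` inside its support: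
no component of `X_{n+1}(ν)` through `x_{n+1}` jumps in depth — res-D-brk-3's conclusion shape, with the near-fibre-subsingleton
hypothesis REPLACED by the surface hypothesis (the fibre of the permissible blow-up over `x_n` is zero-dimensional;
`hasSandwichAt_closure_image_of_surface_centre`). [cite: CossartJannsenSaito2020, Thm. 3.10 (proof, p. 46)] [cite: Matsumura1987, Thm. 15.1] -/
theorem noDepthJumpAt_of_surface_centre {k : Type u} [Field k] (hRf : OracleFunctional R) (hRa : OracleAdmissible R)
    (hν : ν ≠ iterPSum 3 Phi) {s s' : MarkedStage.{u}} (h : CycleInv k R 3 ν s) (hsc : IsClosed ({s.pt} : Set s.W))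
    (hst : CanonicalNearStep R 3 ν s s') {f : s'.W ⟶ s.W} (hf : StepProjection R 3 ν s s' f) {C : s.W.IdealSheafData}
    {P' : Option (Pending (blowup C))} (hcs : IsCanonicalStep R 3 ν s.L s.P C P') (hxC : s.pt ∈ (C.support : Set s.W))
    (hsurf : 2 ≤ coheight (⟨s.pt, hxC⟩ : ↥(C.support : Set s.W))) :
    ∀ Z' ∈ componentsThrough 3 ν s', closure (f.base '' Z') ∈ componentsIn (Scheme.hsStratum s.W 3 ν) →
      HasSandwichAt s' Z' → HasSandwichAt s (closure (f.base '' Z')) := by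
  intro Z' hZ' _ hup
  have h' : CycleInv k R 3 ν s' := h.step hRa hν hst
  exact hasSandwichAt_closure_image_of_surface_centre hRf hRa hν h hsc hf hcs hxC hsurf (componentsIn.isIrreducible hZ'.1)
    (componentsIn.isClosed h'.isClosed_hsStratum hZ'.1) hZ'.2 hup

/-- **res-D-brk-3's STEP LEMMA, CHAR-FREE SURFACE BRANCH.** Same data as `noDepthJumpAt_of_dichotomyAt` at a step under the cycle
invariant; hypothesis AT THIS STEP: EITHER some centre `C` admits a CP frame `(Rf, u, h, φ)` of `x_n` adapted to `C` for which the
rebirth dictionary holds at this step and which carries no ruled-birth datum (curve centre), OR some canonical centre through `x_n`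
has codimension `≥ 2` at `x_n` in its support (surface centre — NO near-fibre hypothesis, NO Thm. 3.14). Conclusion: no component
`Z' ∋ x_{n+1}` of `X_{n+1}(ν)` dominating a component of `X_n(ν)` jumps in depth.
[cite: CossartJannsenSaito2020, Thm. 3.10 (proof, p. 46)] [cite: Matsumura1987, Thm. 15.1] -/
theorem noDepthJumpAt_of_dichotomyAt_charFree {k : Type u} [Field k] (hRf : OracleFunctional R) (hRa : OracleAdmissible R)
    (hν : ν ≠ iterPSum 3 Phi) {s s' : MarkedStage.{u}} (h : CycleInv k R 3 ν s) (hsc : IsClosed ({s.pt} : Set s.W))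
    (hst : CanonicalNearStep R 3 ν s s') {f : s'.W ⟶ s.W} (hf : StepProjection R 3 ν s s' f)
    (hdichAt :
      (∃ (C : s.W.IdealSheafData) (Rf : Type) (_ : CommRing Rf) (u : Fin 3 → Rf) (h : Rf[X])
          (φ : (s.W.presheaf.stalk s.pt : Type u) →+* Rf[X] ⧸ Ideal.span {h}),
          IsCPFrameAlong s C Rf u h φ ∧
            ((∃ Z' ∈ componentsThrough 3 ν s', HasSandwichAt s' Z' ∧
                closure (f.base '' Z') ∈ componentsIn (Scheme.hsStratum s.W 3 ν) ∧ ¬ HasSandwichAt s (closure (f.base '' Z'))) →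
              RuledBirthDatumD u h) ∧
            ¬ RuledBirthDatumD u h) ∨
        (∃ (C : s.W.IdealSheafData) (P' : Option (Pending (blowup C))) (hxC : s.pt ∈ (C.support : Set s.W)),
          IsCanonicalStep R 3 ν s.L s.P C P' ∧ 2 ≤ coheight (⟨s.pt, hxC⟩ : ↥(C.support : Set s.W)))) :
    ∀ Z' ∈ componentsThrough 3 ν s', closure (f.base '' Z') ∈ componentsIn (Scheme.hsStratum s.W 3 ν) →
      HasSandwichAt s' Z' → HasSandwichAt s (closure (f.base '' Z')) := by
  rcases hdichAt with ⟨C, Rf, _, u, h₀, φ, -, hdictAt, hno⟩ | ⟨C, P', hxC, hcs, hsurf⟩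
  · exact noDepthJumpAt_of_frameAt hdictAt hno
  · exact noDepthJumpAt_of_surface_centre hRf hRa hν h hsc hst hf hcs hxC hsurf

/-- **CURVE BRANCH, GEOMETRIC CONTENT FOR THE DICTIONARY'S DISCHARGE.** At one canonical near step at level `3` under the cycle
invariant, `x_n` closed, canonical centre `C` of codimension `≥ 1` at `x_n` in its support, the depth-jump EVENT of `RebirthDictionary3`
(`∃ Z' ∈ componentsThrough 3 ν s'`, sandwich at `x_{n+1}`, image closure a component without sandwich at `x_n`) hands the jumping `Z'` —
a component of `X_{n+1}(ν)` — a whole irreducible component `cl z'` of the fibre `f⁻¹(x_n)` through `x_{n+1}` (`z'` maximal in the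
fibre): `cl z' ⊆ Z' ⊆ X_{n+1}(ν)`. This is the scheme side of «the whole `ℙ¹` over `x_n` is near» (res-type-067 `RuledBirthDatumD`).
[cite: CossartJannsenSaito2020, Thm. 3.10 (proof, p. 46)] [cite: Matsumura1987, Thm. 15.1] -/
theorem exists_fibre_component_subset_of_depthJumpAt {k : Type u} [Field k] (hRf : OracleFunctional R) (hRa : OracleAdmissible R)
    (hν : ν ≠ iterPSum 3 Phi) {s s' : MarkedStage.{u}} (h : CycleInv k R 3 ν s) (hsc : IsClosed ({s.pt} : Set s.W))
    (hst : CanonicalNearStep R 3 ν s s') {f : s'.W ⟶ s.W} (hf : StepProjection R 3 ν s s' f) {C : s.W.IdealSheafData}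
    {P' : Option (Pending (blowup C))} (hcs : IsCanonicalStep R 3 ν s.L s.P C P') (hxC : s.pt ∈ (C.support : Set s.W))
    (hpos : 1 ≤ coheight (⟨s.pt, hxC⟩ : ↥(C.support : Set s.W)))
    (hev : ∃ Z' ∈ componentsThrough 3 ν s', HasSandwichAt s' Z' ∧
      closure (f.base '' Z') ∈ componentsIn (Scheme.hsStratum s.W 3 ν) ∧ ¬ HasSandwichAt s (closure (f.base '' Z'))) :
    ∃ (Z' : Set s'.W) (z' : s'.W), Z' ∈ componentsThrough 3 ν s' ∧ f.base z' = s.pt ∧ z' ⤳ s'.pt ∧ z' ≠ s'.pt ∧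
      (∀ w : s'.W, f.base w = s.pt → w ⤳ z' → w = z') ∧ closure ({z'} : Set s'.W) ⊆ Z' ∧
        closure ({z'} : Set s'.W) ⊆ Scheme.hsStratum s'.W 3 ν := by
  obtain ⟨Z', hZ', hup, -, hdown⟩ := hev
  have h' : CycleInv k R 3 ν s' := h.step hRa hν hst
  obtain ⟨z', hfz, hzx, hne, hmax, hsub⟩ := exists_fibre_component_subset_of_hasSandwichAt hRf hRa hν h hsc hf hcs hxC hpos
    (componentsIn.isIrreducible hZ'.1) (componentsIn.isClosed h'.isClosed_hsStratum hZ'.1) hZ'.2 hup hdown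
  exact ⟨Z', z', hZ', hfz, hzx, hne, hmax, hsub, hsub.trans (componentsIn.subset hZ'.1)⟩

end Summit.ResolutionOfSingularities.ResolutionOfSingularities.Theorems.SigmaMaxModificationsCorridor3.Moving

end
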